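import Literature.Topology.FourManifolds.KhPolyakMove
import Literature.Topology.FourManifolds.KhAntiBigonRotate
import Literature.Topology.FourManifolds.GaussDiagramParityRMoves
import HarnessLib

/-!
# Invariance of the homology over the universal Frobenius system under all oriented Reidemeister moves

Sibling file of `KhPolyakMove.lean` / `KhRMove.lean` for the homology `H^i(G; R, h, t)` of the
Khovanov complex over the universal Frobenius system `R[X]/(X² - hX - t)` (`frobeniusHomology`; Lee
homology at `(ℚ, 0, 1)`, Bar-Natan homology at `(𝔽₂, 1, 0)`, Khovanov homology with `R`
coefficients at `(R, 0, 0)`). The per-move isomorphisms over `(R, h, t)` are all in the tree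
(`nonempty_iso_frobeniusHomology_rotate`, `_omega1a/b` — `KhCurlRotate`; `_omega2a` — `KhBigonRotate`;
`_omega2c` — `KhAntiBigonRotate`; `_omega3a` — `KhTriangleIso`; transfer along a relabelling with a
Koszul potential — `Transfer.nonempty_iso_frobeniusHomology`, `KhComplexTransportProofs`), but they
were only assembled for integral Khovanov homology. This file assembles them, exactly as
`KhComplexTransportProofs` (bookkeeping), `KhEraseChord`/`KhOmega3Degenerate` (degenerate third move)
and `KhPolyakMove`/`KhRMove` (chains) do for `Kh^{i,j}`:

* `nonempty_iso_frobeniusHomology_relabel_swap`, `_relabel`, `_of_isRelabelling` — independence of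
  the numbering of the chords and of the base point;
* `nonempty_iso_frobeniusHomology_eraseChord_of_kink_under/over`,
  `nonempty_iso_frobeniusHomology_omega3a_degenerate` — erasing kinks, the instance `x = z` of `Ω3a`;
* `nonempty_iso_frobeniusHomology_of_polyakMove_of_allEven`, `_of_rMove_of_allEven`,
  `_of_eqvGen_rMove_allEven`, `_of_rEquiv_of_allEven`, and
  **`nonempty_iso_frobeniusHomology_of_rEquiv`: two realisable Gauss diagrams related by `REquiv`
  (all oriented Reidemeister moves, possibly through non-realisable diagrams) have isomorphic
  homology over every Frobenius system `(R, h, t)` in every degree** (in particular isomorphic Lee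
  homology and isomorphic Bar-Natan homology); `_of_equiv` for the smaller relation
  `GaussDiagram.Equiv`.

Everything is proved; no definition and no named fact is introduced.

## References

* M. Khovanov, *A categorification of the Jones polynomial*, Duke Math. J. 101 (2000), Thm. 1,
  §3.3, §5. [cite: Khovanov2000, Thm. 1]
* M. Khovanov, *Link homology and Frobenius extensions*, Fund. Math. 190 (2006), Prop. 6 (the
  universal theory is a link invariant). [cite: Khovanov2006, Prop. 6]
* E. S. Lee, *An endomorphism of the Khovanov invariant*, Adv. Math. 197 (2005), §4. [cite: Lee2005]
* M. Polyak, *Minimal generating sets of Reidemeister moves*, Quantum Topol. 1 (2010), Thm. 1.2.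
  [cite: Polyak2010, Thm 1.2]
* V. O. Manturov, *Free knots and parity* (2012), §3.2, Thm. 2. [cite: Manturov2011, §3.2 Thm. 2]
-/

open CategoryTheory

noncomputable section

namespace Literature.Topology.FourManifolds

namespace GaussDiagram

variable {R : Type} [CommRing R] (hR tR : R)

/-! ## Bookkeeping: numbering of the chords and base point -/

/-- **Swapping the numbers of two adjacent chords does not change the homology over the universal
Frobenius system**: the transfer along `(a b)` with the Koszul potential `koszulSwap a b`
(`edgeSign_swap`). Khovanov (2000), §3.3. [cite: Khovanov2000, §3.3] -/
theorem nonempty_iso_frobeniusHomology_relabel_swap (G : GaussDiagram) (a b : Fin G.n)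
    (hab : (b : ℕ) = a + 1) (i : ℤ) :
    Nonempty (G.frobeniusHomology R hR tR i ≅
      (G.relabel (_root_.Equiv.swap a b)).frobeniusHomology R hR tR i) :=
  (G.relabelTransfer (_root_.Equiv.swap a b)).nonempty_iso_frobeniusHomology hR tR
    (fun σ ↦ ((koszulSwap a b σ : ℤ) : R))
    (fun σ ↦ by rw [← Int.cast_mul, koszulSwap_mul_self, Int.cast_one]) (fun σ i hi ↦ by
      show ((edgeSign (σ ∘ ⇑(_root_.Equiv.swap a b)) (_root_.Equiv.swap a b i) : ℤ) : R) =
        ((koszulSwap a b σ : ℤ) : R) * ((koszulSwap a b (Function.update σ i true) : ℤ) : R) *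
          ((edgeSign σ i : ℤ) : R)
      rw [edgeSign_swap a b hab σ i hi]
      push_cast
      ring) i

/-- **The homology over the universal Frobenius system does not depend on the numbering of the
chords** (`GaussDiagram.relabel`): adjacent transpositions generate the symmetric group
(`Equiv.Perm.mclosure_swap_castSucc_succ`). Khovanov (2000), §3.3. [cite: Khovanov2000, §3.3] -/
theorem nonempty_iso_frobeniusHomology_relabel (G : GaussDiagram)
    (π : _root_.Equiv.Perm (Fin G.n)) (i : ℤ) :
    Nonempty (G.frobeniusHomology R hR tR i ≅ (G.relabel π).frobeniusHomology R hR tR i) := by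
  obtain ⟨n, o, u, sg, hb⟩ := G
  cases n with
  | zero =>
    have : π = 1 := Subsingleton.elim _ _
    subst this
    rw [relabel_one]
    exact ⟨Iso.refl _⟩
  | succ m =>
    have hπ : π ∈ Submonoid.closure
        (Set.range fun i : Fin m ↦ _root_.Equiv.swap i.castSucc i.succ) := by
      rw [_root_.Equiv.Perm.mclosure_swap_castSucc_succ m]; exact Submonoid.mem_top π
    suffices H : ∀ π ∈ Submonoid.closure
        (Set.range fun i : Fin m ↦ _root_.Equiv.swap i.castSucc i.succ),
        ∀ (o u : Fin (m + 1) → Fin (2 * (m + 1))) (sg : Fin (m + 1) → ℤˣ)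
          (hb : Function.Bijective (Sum.elim o u)),
          Nonempty (GaussDiagram.frobeniusHomology ⟨m + 1, o, u, sg, hb⟩ R hR tR i ≅
            (GaussDiagram.relabel ⟨m + 1, o, u, sg, hb⟩ π).frobeniusHomology R hR tR i) from
      H π hπ o u sg hb
    intro π hπ
    refine Submonoid.closure_induction (fun π' hπ' ↦ ?_) ?_ (fun π₁ π₂ _ _ h₁ h₂ ↦ ?_) hπ
    · obtain ⟨k, rfl⟩ := hπ'
      intro o u sg hb
      exact nonempty_iso_frobeniusHomology_relabel_swap hR tR ⟨m + 1, o, u, sg, hb⟩ k.castSucc k.succ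
        (by simp [Fin.val_succ]) i
    · intro o u sg hb
      rw [relabel_one]
      exact ⟨Iso.refl _⟩
    · intro o u sg hb
      rw [relabel_mul]
      obtain ⟨e₁⟩ := h₁ o u sg hb
      obtain ⟨e₂⟩ := h₂ (o ∘ ⇑π₁) (u ∘ ⇑π₁) (sg ∘ ⇑π₁)
        (GaussDiagram.relabel ⟨m + 1, o, u, sg, hb⟩ π₁).bijective
      exact ⟨e₁ ≪≫ e₂⟩

/-- **Invariance of the homology over the universal Frobenius system under the bookkeeping move**
`PolyakMove.relabel` (renumbering of the chords and change of base point), for all Gauss diagrams.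
Khovanov (2000), §3.3, §4.2. [cite: Khovanov2000, §3.3] -/
theorem nonempty_iso_frobeniusHomology_of_isRelabelling {G G' : GaussDiagram}
    (h : G.IsRelabelling G') (i : ℤ) :
    Nonempty (G.frobeniusHomology R hR tR i ≅ G'.frobeniusHomology R hR tR i) := by
  obtain ⟨σ, k, rfl⟩ := h
  obtain ⟨e₁⟩ := nonempty_iso_frobeniusHomology_relabel hR tR G σ i
  obtain ⟨e₂⟩ := nonempty_iso_frobeniusHomology_rotate (G.relabel σ) hR tR k i
  exact ⟨e₁ ≪≫ e₂⟩

/-! ## Erasing kinks and the degenerate third move -/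

/-- **An isolated kink entered along the under-strand can be erased without changing the homology
over the universal Frobenius system** (`Ω1b` backwards, plus renumbering). Khovanov (2000), §5.1,
§3.3. [cite: Khovanov2000, §5.1] -/
theorem nonempty_iso_frobeniusHomology_eraseChord_of_kink_under (G : GaussDiagram) (x : Fin G.n)
    (h : (G.overPos x : ℕ) = G.underPos x + 1) (i : ℤ) :
    Nonempty (G.frobeniusHomology R hR tR i ≅ (G.eraseChord x).frobeniusHomology R hR tR i) := by
  obtain ⟨e₁⟩ := nonempty_iso_frobeniusHomology_relabel hR tR G (G.eraseCycle x) i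
  obtain ⟨e₂⟩ := (G.eraseChord x).nonempty_iso_frobeniusHomology_omega1b (G.eraseU x) (G.sign x) hR tR i
  rw [← G.eraseO_eq_succ x h, G.insertChord_eraseChord x] at e₂
  exact ⟨e₁ ≪≫ e₂.symm⟩

/-- **An isolated kink entered along the over-strand can be erased without changing the homology
over the universal Frobenius system** (`Ω1a` backwards). Khovanov (2000), §5.1, §3.3.
[cite: Khovanov2000, §5.1] -/
theorem nonempty_iso_frobeniusHomology_eraseChord_of_kink_over (G : GaussDiagram) (x : Fin G.n)
    (h : (G.underPos x : ℕ) = G.overPos x + 1) (i : ℤ) :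
    Nonempty (G.frobeniusHomology R hR tR i ≅ (G.eraseChord x).frobeniusHomology R hR tR i) := by
  obtain ⟨e₁⟩ := nonempty_iso_frobeniusHomology_relabel hR tR G (G.eraseCycle x) i
  obtain ⟨e₂⟩ := (G.eraseChord x).nonempty_iso_frobeniusHomology_omega1a (G.eraseU x) (G.sign x) hR tR i
  rw [← G.eraseO_eq_castSucc x h, G.insertChord_eraseChord x] at e₂
  exact ⟨e₁ ≪≫ e₂.symm⟩

/-- **Invariance of the homology over the universal Frobenius system under the degenerate instance
`x = z` of `Ω3a`**: erase the kink `x`, then the kink `y`, from both sides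
(`eraseChord_eraseChord_eq`). Khovanov (2000), §5.1, §3.3. [cite: Khovanov2000, §5.1] -/
theorem nonempty_iso_frobeniusHomology_omega3a_degenerate (G : GaussDiagram) {x y : Fin G.n}
    (ha : (G.overPos y : ℕ) = G.overPos x + 1) (hb : (G.overPos x : ℕ) = G.underPos x + 1)
    (hc : (G.underPos x : ℕ) = G.underPos y + 1) (i : ℤ) :
    Nonempty (G.frobeniusHomology R hR tR i ≅ (G.braidMove x y x).frobeniusHomology R hR tR i) := by
  have hxy : x ≠ y := by rintro rfl; omega
  obtain ⟨e₁⟩ := G.nonempty_iso_frobeniusHomology_eraseChord_of_kink_under hR tR x hb i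
  obtain ⟨e₂⟩ := (G.eraseChord x).nonempty_iso_frobeniusHomology_eraseChord_of_kink_under hR tR
    (G.yIdx x y hxy) (G.kink_eraseChord_G ha hb hc hxy) i
  obtain ⟨e₃⟩ := (G.braidMove x y x).nonempty_iso_frobeniusHomology_eraseChord_of_kink_under hR tR x
    (G.kink_x_G' hc hxy) i
  obtain ⟨e₄⟩ := ((G.braidMove x y x).eraseChord x).nonempty_iso_frobeniusHomology_eraseChord_of_kink_over
    hR tR ((G.braidMove x y x).yIdx x y hxy) (G.kink_eraseChord_G' ha hb hc hxy) i
  rw [← G.eraseChord_eraseChord_eq ha hb hc hxy] at e₄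
  exact ⟨e₁ ≪≫ e₂ ≪≫ e₄.symm ≪≫ e₃.symm⟩

/-! ## Single moves between all-even diagrams, chains, `Equiv` and `REquiv` -/

/-- **The homology over the universal Frobenius system is invariant under every Polyak move
between all-even Gauss diagrams** (merge-or-split from Gauss's parity condition,
`isMergeAt_or_isSplitAt_of_overPos_mod_two_ne`). Khovanov (2000), Thm. 1, §5; Khovanov (2006),
Prop. 6. [cite: Khovanov2000, Thm. 1] -/
theorem nonempty_iso_frobeniusHomology_of_polyakMove_of_allEven {G G' : GaussDiagram}
    (h : PolyakMove G G') (hG : G.AllEven) (hG' : G'.AllEven) (i : ℤ) :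
    Nonempty (G.frobeniusHomology R hR tR i ≅ G'.frobeniusHomology R hR tR i) := by
  cases h
  case relabel hrel => exact nonempty_iso_frobeniusHomology_of_isRelabelling hR tR hrel i
  case omega1a p ε => exact G.nonempty_iso_frobeniusHomology_omega1a p ε hR tR i
  case omega1b p ε => exact G.nonempty_iso_frobeniusHomology_omega1b p ε hR tR i
  case omega2a o u o' u' ε hover hunder =>
    exact G.nonempty_iso_frobeniusHomology_omega2a o u o' u' ε hover hunder
      (fun _ _ hτ ↦ isMergeAt_or_isSplitAt_of_overPos_mod_two_ne hG' hτ) hR tR i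
  case omega3a x y z hx hy hz ha hb hc =>
    by_cases hxz : x = z
    · subst hxz
      exact G.nonempty_iso_frobeniusHomology_omega3a_degenerate hR tR ha hb hc i
    · exact G.nonempty_iso_frobeniusHomology_omega3a hxz ha hb hc hx hy hz hR tR
        (fun _ _ hτ ↦ isMergeAt_or_isSplitAt_of_overPos_mod_two_ne hG hτ)
        (fun _ _ hτ ↦ isMergeAt_or_isSplitAt_of_overPos_mod_two_ne hG' hτ) i

/-- **The homology over the universal Frobenius system is invariant under every move of `RMove`
between all-even Gauss diagrams** (the anti-parallel second move by
`nonempty_iso_frobeniusHomology_omega2c`). [cite: Khovanov2000, Thm. 1] -/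
theorem nonempty_iso_frobeniusHomology_of_rMove_of_allEven {G G' : GaussDiagram} (h : RMove G G')
    (hG : G.AllEven) (hG' : G'.AllEven) (i : ℤ) :
    Nonempty (G.frobeniusHomology R hR tR i ≅ G'.frobeniusHomology R hR tR i) := by
  cases h with
  | polyak h => exact nonempty_iso_frobeniusHomology_of_polyakMove_of_allEven hR tR h hG hG' i
  | omega2c o u o' u' ε hover hunder =>
    obtain ⟨e⟩ := G.nonempty_iso_frobeniusHomology_omega2c o u o' u' ε hover hunder
      (fun _ _ hτ ↦ isMergeAt_or_isSplitAt_of_overPos_mod_two_ne hG' hτ) hR tR i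
    exact ⟨e.symm⟩

/-- **The homology over the universal Frobenius system is invariant along every chain of moves of
`RMove` through all-even Gauss diagrams.** [cite: Khovanov2000, Thm. 1] -/
theorem nonempty_iso_frobeniusHomology_of_eqvGen_rMove_allEven {G G' : GaussDiagram}
    (h : Relation.EqvGen (fun A B ↦ RMove A B ∧ A.AllEven ∧ B.AllEven) G G') (i : ℤ) :
    Nonempty (G.frobeniusHomology R hR tR i ≅ G'.frobeniusHomology R hR tR i) := by
  induction h with
  | rel A B hAB => exact nonempty_iso_frobeniusHomology_of_rMove_of_allEven hR tR hAB.1 hAB.2.1 hAB.2.2 i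
  | refl A => exact ⟨Iso.refl _⟩
  | symm A B _ ih => obtain ⟨e⟩ := ih; exact ⟨e.symm⟩
  | trans A B C _ _ ih₁ ih₂ => obtain ⟨e₁⟩ := ih₁; obtain ⟨e₂⟩ := ih₂; exact ⟨e₁ ≪≫ e₂⟩

/-- **Invariance under `REquiv` between all-even diagrams** (Manturov's projection theorem for
`RMove`, `eqvGen_rMove_allEven_of_rEquiv`). [cite: Manturov2011, §3.2 Thm. 2] -/
theorem nonempty_iso_frobeniusHomology_of_rEquiv_of_allEven {G G' : GaussDiagram} (hG : G.AllEven)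
    (hG' : G'.AllEven) (e : G.REquiv G') (i : ℤ) :
    Nonempty (G.frobeniusHomology R hR tR i ≅ G'.frobeniusHomology R hR tR i) :=
  nonempty_iso_frobeniusHomology_of_eqvGen_rMove_allEven hR tR (eqvGen_rMove_allEven_of_rEquiv hG hG' e) i

/-- **Invariance of the homology over the universal Frobenius system under all oriented
Reidemeister moves**: two *realisable* Gauss diagrams related by `GaussDiagram.REquiv` (the moves of
`RMove` and their inverses, possibly through non-realisable diagrams) have isomorphic homology
`H^i(–; R, h, t)` for every `(R, h, t)` and every `i` — in particular isomorphic Lee homology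
(`(ℚ, 0, 1)`) and Bar-Natan homology (`(𝔽₂, 1, 0)`). Khovanov (2000), Thm. 1; Khovanov (2006),
Prop. 6; Polyak (2010), Thm. 1.2. [cite: Khovanov2006, Prop. 6] -/
theorem nonempty_iso_frobeniusHomology_of_rEquiv {G G' : GaussDiagram}
    (hG : ∃ K : Knot, K.HasGaussDiagram G) (hG' : ∃ K : Knot, K.HasGaussDiagram G')
    (e : G.REquiv G') (i : ℤ) :
    Nonempty (G.frobeniusHomology R hR tR i ≅ G'.frobeniusHomology R hR tR i) := by
  obtain ⟨K, hK⟩ := hG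
  obtain ⟨K', hK'⟩ := hG'
  exact nonempty_iso_frobeniusHomology_of_rEquiv_of_allEven hR tR hK.allEven hK'.allEven e i

/-- **Invariance under `GaussDiagram.Equiv`** (Polyak's smaller move set) between realisable
diagrams — the universal-Frobenius-system analogue of `nonempty_iso_khovanovHomology_of_equiv_holds`.
[cite: Khovanov2006, Prop. 6] -/
theorem nonempty_iso_frobeniusHomology_of_equiv {G G' : GaussDiagram}
    (hG : ∃ K : Knot, K.HasGaussDiagram G) (hG' : ∃ K : Knot, K.HasGaussDiagram G')
    (e : G.Equiv G') (i : ℤ) :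
    Nonempty (G.frobeniusHomology R hR tR i ≅ G'.frobeniusHomology R hR tR i) :=
  nonempty_iso_frobeniusHomology_of_rEquiv hR tR hG hG' e.rEquiv i

end GaussDiagram

end Literature.Topology.FourManifolds
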